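import Mathlib
import Summits.NavierStokesRegularity.NavierStokesRegularity.Theorems.PlaneEnergyCeilingPlanarEnergyAPrioriDynamicCeiling
import Summits.NavierStokesRegularity.NavierStokesRegularity.Theorems.PlaneEnergyCeilingPlanarEnergyAPrioriKernelLog

/-!
# Route PlaneEnergyCeiling · crux `PlanarEnergyAPriori` — Leray-rate enstrophy ⇒ `log²` planar ceiling

Helper file for the crux item stmt-NavierStokesRegularity-16855 (`PlanarEnergyAPriori`), landed
`--supports` that item: the conditional corollary `TypeIEnstrophyLogSqCeiling` of the strategist
census (gen 1, A-S6 (S6)(ii)), now a THEOREM from the landed dynamic planar ceiling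
(`dynamicPlanarCeiling`) and the logarithmic kernel bound (`logKernelBound`):

along a classical solution of unforced Navier–Stokes on `ℝ³ × [0,T)` that is Leray–Hopf from a rapidly
decaying datum, IF the enstrophy obeys the Leray-rate ("Type I") bound `∫‖Du(s)‖² ≤ C_Z (T−s)^{-1/2}`
on `(0,T)`, THEN the planar energies grow at most like `A + B log²(T/(T−t))` as `t ↑ T`
(`planarEnergy_le_logSq_of_lerayRateEnstrophy`). Static Agmon gives only `(T−t)^{-1/4}` from the
same hypothesis; the scarred Type-I profile has `log¹`. The half-potential estimate is
`∫₀^{t'} (t'−s)^{-1/2} C_Z (T−s)^{-1/2} ds ≤ C_Z (2 + log(T/(T−t')))`.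
-/

noncomputable section

-- single-conjunct summit: `Summit.<Summit>.<Problem>` repeats the name by the D-0017 layout
set_option linter.dupNamespace false

namespace Summit.NavierStokesRegularity.NavierStokesRegularity.Theorems.PlanarEnergyAPriori

open MeasureTheory Set Filter Topology Function WithLp
open scoped ENNReal NNReal
open Literature.Analysis.FluidPDE

variable {ν T : ℝ} {u : ℝ → EuclideanSpace ℝ (Fin 3) → EuclideanSpace ℝ (Fin 3)} {p : ℝ → EuclideanSpace ℝ (Fin 3) → ℝ}

/-- **The enstrophy half-potential under a Leray-rate bound is logarithmic**: if
`∫‖Du(s)‖² ≤ C_Z (T−s)^{-1/2}` on `(0,T)`, then for `0 ≤ t' ≤ t < T`,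
`∫_{(0,t')} (t'−s)^{-1/2} ∫‖Du(s)‖² ds ≤ C_Z (2 + log(T/(T−t)))`. -/
theorem halfPotential_le_log_of_lerayRateEnstrophy {C_Z : ℝ} (hCZ : 0 ≤ C_Z)
    (hZ : ∀ s ∈ Ioo 0 T, ∫⁻ x, ‖fderiv ℝ (u s) x‖ₑ ^ 2 ≤ ENNReal.ofReal (C_Z * (Real.sqrt (T - s))⁻¹))
    {t t' : ℝ} (ht : t < T) (ht' : t' ∈ Icc 0 t) :
    (∫⁻ s in Ioo 0 t', ENNReal.ofReal ((Real.sqrt (t' - s))⁻¹) * ∫⁻ x, ‖fderiv ℝ (u s) x‖ₑ ^ 2) ≤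
      ENNReal.ofReal (C_Z * (2 + Real.log (T / (T - t)))) := by
  rcases eq_or_lt_of_le ht'.1 with h0 | ht'pos
  · subst h0; simp
  have ht'T : t' < T := lt_of_le_of_lt ht'.2 ht
  have hT : 0 < T := ht'pos.trans ht'T
  have hlog : Real.log (T / (T - t')) ≤ Real.log (T / (T - t)) :=
    Real.log_le_log (div_pos hT (by linarith)) (div_le_div_of_nonneg_left hT.le (by linarith) (by linarith [ht'.2]))
  have hlog0 : 0 ≤ Real.log (T / (T - t')) := Real.log_nonneg (by rw [le_div_iff₀ (by linarith)]; linarith)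
  calc (∫⁻ s in Ioo 0 t', ENNReal.ofReal ((Real.sqrt (t' - s))⁻¹) * ∫⁻ x, ‖fderiv ℝ (u s) x‖ₑ ^ 2)
      ≤ ∫⁻ s in Ioo 0 t', ENNReal.ofReal C_Z *
          (ENNReal.ofReal ((Real.sqrt (t' - s))⁻¹) * ENNReal.ofReal ((Real.sqrt (T - s))⁻¹)) := by
        refine setLIntegral_mono' measurableSet_Ioo fun s hs => ?_
        calc _ ≤ ENNReal.ofReal ((Real.sqrt (t' - s))⁻¹) * ENNReal.ofReal (C_Z * (Real.sqrt (T - s))⁻¹) :=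
              mul_le_mul' le_rfl (hZ s ⟨hs.1, hs.2.trans ht'T⟩)
          _ = _ := by rw [ENNReal.ofReal_mul hCZ]; ring
    _ = ENNReal.ofReal C_Z * ∫⁻ s in Ioo 0 t', ENNReal.ofReal ((Real.sqrt (t' - s))⁻¹) * ENNReal.ofReal ((Real.sqrt (T - s))⁻¹) :=
        lintegral_const_mul' _ _ ENNReal.ofReal_ne_top
    _ ≤ ENNReal.ofReal C_Z * ENNReal.ofReal (2 + Real.log (T / (T - t'))) :=
        mul_le_mul' le_rfl (logKernelBound t' T ht'pos ht'T)
    _ ≤ ENNReal.ofReal C_Z * ENNReal.ofReal (2 + Real.log (T / (T - t))) := by gcongr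
    _ = ENNReal.ofReal (C_Z * (2 + Real.log (T / (T - t)))) := (ENNReal.ofReal_mul hCZ).symm

/-- **Leray-rate enstrophy ⇒ `log²` planar ceiling** (section form). -/
theorem planarEnergy_le_logSq_of_lerayRateEnstrophy' (hν : 0 < ν) (hT : 0 < T)
    (hcl : IsClassicalNSSolutionOn (Ico 0 T) ν 0 u p) (hLH : IsLerayHopfOn T ν 0 (u 0) u)
    (hdec : HasRapidSpatialDecay (u 0)) {C_Z : ℝ} (hCZ : 0 ≤ C_Z)
    (hZ : ∀ s ∈ Ioo 0 T, ∫⁻ x, ‖fderiv ℝ (u s) x‖ₑ ^ 2 ≤ ENNReal.ofReal (C_Z * (Real.sqrt (T - s))⁻¹)) :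
    ∃ A B : ℝ, ∀ t ∈ Ico 0 T, ∀ (R : EuclideanSpace ℝ (Fin 3) ≃ₗᵢ[ℝ] EuclideanSpace ℝ (Fin 3)) (c : ℝ),
      ∫⁻ y : EuclideanSpace ℝ (Fin 2), ‖u t (R (toLp 2 ![y 0, y 1, c]))‖ₑ ^ 2 ≤
        ENNReal.ofReal (A + B * (Real.log (T / (T - t))) ^ 2) := by
  obtain ⟨C, hC0, hC⟩ := dynamicPlanarCeiling
  obtain ⟨M₀, hM₀, hinit⟩ := stub_initialPlanarCeiling (u 0) hdec
  have hCν : 0 ≤ C / ν := div_nonneg hC0 hν.le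
  refine ⟨2 * M₀ + C / ν * (8 * C_Z ^ 2), C / ν * (2 * C_Z ^ 2), fun t ht R c => ?_⟩
  have h := hC ν T hν hT u p hcl hLH hdec t ht R c
  set L : ℝ := Real.log (T / (T - t)) with hL
  have hL0 : 0 ≤ L := Real.log_nonneg (by rw [le_div_iff₀ (by linarith [ht.2])]; linarith [ht.1])
  have hP0 : (⨆ (R' : EuclideanSpace ℝ (Fin 3) ≃ₗᵢ[ℝ] EuclideanSpace ℝ (Fin 3)) (c' : ℝ),
      ∫⁻ y : EuclideanSpace ℝ (Fin 2), ‖u 0 (R' (toLp 2 ![y 0, y 1, c']))‖ₑ ^ 2) ≤ ENNReal.ofReal M₀ :=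
    iSup₂_le fun R' c' => hinit R' c'
  have hW : (⨆ t' ∈ Icc 0 t, ∫⁻ s in Ioo 0 t', ENNReal.ofReal ((Real.sqrt (t' - s))⁻¹) *
      ∫⁻ x, ‖fderiv ℝ (u s) x‖ₑ ^ 2) ≤ ENNReal.ofReal (C_Z * (2 + L)) :=
    iSup₂_le fun t' ht' => halfPotential_le_log_of_lerayRateEnstrophy hCZ hZ ht.2 ht'
  have hW2 : (⨆ t' ∈ Icc 0 t, ∫⁻ s in Ioo 0 t', ENNReal.ofReal ((Real.sqrt (t' - s))⁻¹) *
      ∫⁻ x, ‖fderiv ℝ (u s) x‖ₑ ^ 2) ^ 2 ≤ ENNReal.ofReal (8 * C_Z ^ 2 + 2 * C_Z ^ 2 * L ^ 2) := by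
    calc _ ≤ (ENNReal.ofReal (C_Z * (2 + L))) ^ 2 := pow_le_pow_left' hW 2
      _ = ENNReal.ofReal ((C_Z * (2 + L)) ^ 2) := (ENNReal.ofReal_pow (by positivity) 2).symm
      _ ≤ ENNReal.ofReal (8 * C_Z ^ 2 + 2 * C_Z ^ 2 * L ^ 2) :=
          ENNReal.ofReal_le_ofReal (by nlinarith [sq_nonneg (2 - L), sq_nonneg C_Z])
  calc _ ≤ _ := h
    _ ≤ 2 * ENNReal.ofReal M₀ + ENNReal.ofReal (C / ν) * ENNReal.ofReal (8 * C_Z ^ 2 + 2 * C_Z ^ 2 * L ^ 2) := by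
        gcongr
    _ = ENNReal.ofReal (2 * M₀ + C / ν * (8 * C_Z ^ 2) + C / ν * (2 * C_Z ^ 2) * L ^ 2) := by
        rw [← ENNReal.ofReal_ofNat, ← ENNReal.ofReal_mul (by norm_num), ← ENNReal.ofReal_mul hCν,
          ← ENNReal.ofReal_add (by positivity) (by positivity)]
        congr 1; ring

/-- **LERAY-RATE ENSTROPHY ⇒ `log²` PLANAR CEILING** (registered closed form, sub-goal
`planarEnergy_le_logSq_of_lerayRateEnstrophy` of stmt-NavierStokesRegularity-16855; the strategist
census's `TypeIEnstrophyLogSqCeiling`, now unconditional). Along every classical solution of unforced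
Navier–Stokes on `ℝ³ × [0,T)` (`ν > 0`) that is Leray–Hopf from a rapidly decaying datum: if
`∫ ‖Du(s)‖² ≤ C_Z (T−s)^{-1/2}` for `s ∈ (0,T)` (the enstrophy at exactly Leray's lower blow-up
rate), then there are `A, B` with `∫_{ℝ²} ‖u(t, R(y₀,y₁,c))‖² dy ≤ A + B log²(T/(T−t))` for all
`t ∈ [0,T)`, all linear isometries `R` and offsets `c` — in the Leray-rate class the planar energy
ceiling is one logarithm away (static Agmon: `(T−t)^{-1/4}`; scarred Type-I profile: `log¹`). -/
theorem planarEnergy_le_logSq_of_lerayRateEnstrophy : ∀ (ν T : ℝ), 0 < ν → 0 < T → ∀ (u : ℝ → EuclideanSpace ℝ (Fin 3) → EuclideanSpace ℝ (Fin 3)) (p : ℝ → EuclideanSpace ℝ (Fin 3) → ℝ), Literature.Analysis.FluidPDE.IsClassicalNSSolutionOn (Set.Ico 0 T) ν 0 u p → Literature.Analysis.FluidPDE.IsLerayHopfOn T ν 0 (u 0) u → Literature.Analysis.FluidPDE.HasRapidSpatialDecay (u 0) → ∀ (C_Z : ℝ), 0 ≤ C_Z → (∀ s ∈ Set.Ioo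 0 T, ∫⁻ x, ‖fderiv ℝ (u s) x‖ₑ ^ 2 ≤ ENNReal.ofReal (C_Z * (Real.sqrt (T - s))⁻¹)) → ∃ A B : ℝ, ∀ t ∈ Set.Ico 0 T, ∀ (R : EuclideanSpace ℝ (Fin 3) ≃ₗᵢ[ℝ] EuclideanSpace ℝ (Fin 3)) (c : ℝ), ∫⁻ y : EuclideanSpace ℝ (Fin 2), ‖u t (R (WithLp.toLp 2 ![y 0, y 1, c]))‖ₑ ^ 2 ≤ ENNReal.ofReal (A + B * (Real.log (T / (T - t))) ^ 2) :=
  fun _ _ hν hT _ _ hcl hLH hdec _ hCZ hZ => planarEnergy_le_logSq_of_lerayRateEnstrophy' hν hT hcl hLH hdec hCZ hZ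

end Summit.NavierStokesRegularity.NavierStokesRegularity.Theorems.PlanarEnergyAPriori

end
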